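import Mathlib
import HarnessLib

/-!
# Venture HSemireg — the degree-one supertrace law (Σ) for THREE-level reduced-point complexes

HONEST FRAMING. Lean leaf for the computation cell `pub-hsemireg` (target seat t-5 gen 15; files of
record `run/shared/lean/pub/pub-hsemireg/target-g6/W3-SIGMA-t5g14.md` §3.8 and
`target-g6/SIGMA4-t5g15.md` §1, 2026-08-23/24). In the minimal twisted-complex model of a
«reduced-point complex» on a smooth threefold germ the Killing relation (E1) for two coordinate
directions reads, with `a, b` raising the level and `c, e` lowering it, `{a,e} = 0`, `{b,c} = 0`,
`{a,c} + {b,e} = 0` on every level. The law (Σ) says that the alternating sum over the levels of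
the traces of the loops `a ∘ c` vanishes; it is not a linear consequence of the relations. The
two-level case is `FibreTestSigmaTwoLevel`. THIS FILE kernel-checks the THREE-level case
`M₀, M₁, M₂` in full generality (all dimensions, any field): `trace (a₀ ∘ c₁) = trace (a₁ ∘ c₂)`.
The proof is the six-line argument of SIGMA4-t5g15 §1: with `P = a₀c₁`, `R = b₀e₁`, `P' = c₂a₁`,
`R' = e₂b₁` on the middle level, `Λ = P + R` and `N = P + R'` satisfy `N Λ = Λ N = 0`, and `P`, `R'`
square to `P Λ`, `-R' Λ`; so on `W = ker Λ ⊇ im N` both `P` and `R'` are square-zero, hence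
`trace N = 0` (nilpotent ⇒ traceless — the non-formal step), and `trace N = trace P - trace (a₁c₂)`.
Only the nine componentwise relations listed in the hypotheses are used. The model, the numerics
and everything about ≥ 4 levels are NOT formalised. No object is constructed; nothing here bears
on HC, HC_CM or HC_AV.
-/

namespace Summit.Ventures.HSemireg

open LinearMap

variable {F : Type*} [Field F]
variable {M₀ M₁ M₂ : Type*} [AddCommGroup M₀] [Module F M₀] [AddCommGroup M₁] [Module F M₁]
  [AddCommGroup M₂] [Module F M₂]

/-- **Square-zero sandwich ⇒ traceless.** If an endomorphism `N` of a finite-dimensional space is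
killed on the left by `Λ` (`Λ N = 0`) and splits as `N = P + R'` where `P` and `R'` commute with `Λ`
in the weak sense `Λ P = P Λ`, `Λ R' = R' Λ` and square to multiples of `Λ` on the right
(`P P = P Λ`, `R' R' = -(R' Λ)`), then `trace N = 0`: on `ker Λ ⊇ im N` both summands are
square-zero. [folklore] -/
theorem trace_eq_zero_of_sandwich [FiniteDimensional F M₁] (P R' Λ : Module.End F M₁)
    (hΛN : Λ * (P + R') = 0) (hP : Λ * P = P * Λ) (hR : Λ * R' = R' * Λ)
    (hPP : P * P = P * Λ) (hRR : R' * R' = -(R' * Λ)) :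
    LinearMap.trace F M₁ (P + R') = 0 := by
  obtain ⟨q, hq⟩ := (LinearMap.ker Λ).exists_isCompl
  set π : Module.End F M₁ :=
    (LinearMap.ker Λ).subtype ∘ₗ (LinearMap.ker Λ).projectionOnto q hq with hπdef
  have hπ_mem : ∀ x, π x ∈ LinearMap.ker Λ := fun x => Submodule.coe_mem _
  have hπ_id : ∀ w ∈ LinearMap.ker Λ, π w = w := by
    intro w hw
    have h2 : (LinearMap.ker Λ).projectionOnto q hq w = ⟨w, hw⟩ :=
      Submodule.projectionOnto_apply_left hq ⟨w, hw⟩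
    simp only [hπdef, LinearMap.coe_comp, Submodule.coe_subtype, Function.comp_apply, h2]
  have hΛπ : Λ * π = 0 := by
    ext x
    exact LinearMap.mem_ker.mp (hπ_mem x)
  -- N maps into ker Λ, so π N = N
  have hπN : π * (P + R') = P + R' := by
    ext x
    simp only [Module.End.mul_apply]
    apply hπ_id
    rw [LinearMap.mem_ker]
    have := congrArg (fun T : Module.End F M₁ => T x) hΛN
    simpa only [Module.End.mul_apply, LinearMap.zero_apply] using this
  -- P and R' preserve ker Λ
  have hπP : π * (P * π) = P * π := by
    ext x
    simp only [Module.End.mul_apply]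
    apply hπ_id
    rw [LinearMap.mem_ker]
    have h1 : Λ (P (π x)) = P (Λ (π x)) := by
      have := congrArg (fun T : Module.End F M₁ => T (π x)) hP
      simpa only [Module.End.mul_apply] using this
    rw [h1, LinearMap.mem_ker.mp (hπ_mem x), map_zero]
  have hπR : π * (R' * π) = R' * π := by
    ext x
    simp only [Module.End.mul_apply]
    apply hπ_id
    rw [LinearMap.mem_ker]
    have h1 : Λ (R' (π x)) = R' (Λ (π x)) := by
      have := congrArg (fun T : Module.End F M₁ => T (π x)) hR
      simpa only [Module.End.mul_apply] using this
    rw [h1, LinearMap.mem_ker.mp (hπ_mem x), map_zero]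
  -- the compressions are square-zero
  have hsqP : (P * π) * (P * π) = 0 := by
    calc (P * π) * (P * π) = P * (π * (P * π)) := by noncomm_ring
      _ = (P * P) * π := by rw [hπP]; noncomm_ring
      _ = P * (Λ * π) := by rw [hPP]; noncomm_ring
      _ = 0 := by rw [hΛπ, mul_zero]
  have hsqR : (R' * π) * (R' * π) = 0 := by
    calc (R' * π) * (R' * π) = R' * (π * (R' * π)) := by noncomm_ring
      _ = (R' * R') * π := by rw [hπR]; noncomm_ring
      _ = -(R' * (Λ * π)) := by rw [hRR]; noncomm_ring
      _ = 0 := by rw [hΛπ, mul_zero, neg_zero]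
  have htP : LinearMap.trace F M₁ (P * π) = 0 :=
    (LinearMap.isNilpotent_trace_of_isNilpotent ⟨2, by rw [pow_two, hsqP]⟩).eq_zero
  have htR : LinearMap.trace F M₁ (R' * π) = 0 :=
    (LinearMap.isNilpotent_trace_of_isNilpotent ⟨2, by rw [pow_two, hsqR]⟩).eq_zero
  calc LinearMap.trace F M₁ (P + R') = LinearMap.trace F M₁ (π * (P + R')) := by rw [hπN]
    _ = LinearMap.trace F M₁ ((P + R') * π) := LinearMap.trace_mul_comm F π (P + R')
    _ = LinearMap.trace F M₁ (P * π) + LinearMap.trace F M₁ (R' * π) := by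
        rw [add_mul, map_add]
    _ = 0 := by rw [htP, htR, add_zero]

/-- **(Σ) for three levels** (SIGMA4-t5g15 §1; W3-SIGMA-t5g14 §3.8). Levels `M₀, M₁, M₂`,
raising maps `a₀ b₀ : M₀ → M₁`, `a₁ b₁ : M₁ → M₂`, lowering maps `c₁ e₁ : M₁ → M₀`,
`c₂ e₂ : M₂ → M₁`, and the nine componentwise Killing relations (`{a,e} = 0`, `{b,c} = 0`,
`{a,c}+{b,e} = 0` on each of the three levels). Then `trace (a₀ ∘ c₁) = trace (a₁ ∘ c₂)`, i.e.
the supertrace `Σ_p (-1)^p tr(a c | M_p)` vanishes. Proof: with `P = a₀c₁, R = b₀e₁, P' = c₂a₁,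
R' = e₂b₁`, the boundary relations give `PR = RP = P'R' = R'P' = 0`, the middle ones give
`P² = R'²` and `P + R = -(P' + R')`, whence `N Λ = Λ N = 0` for `Λ = P + R`, `N = P + R'`, and
`trace_eq_zero_of_sandwich` gives `trace P + trace R' = 0 = trace P - trace (a₁c₂)`. [folklore] -/
theorem trace_sigmaLoop_three_level [FiniteDimensional F M₁] [FiniteDimensional F M₂]
    (a₀ b₀ : M₀ →ₗ[F] M₁) (a₁ b₁ : M₁ →ₗ[F] M₂) (c₁ e₁ : M₁ →ₗ[F] M₀) (c₂ e₂ : M₂ →ₗ[F] M₁)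
    (h0i : e₁ ∘ₗ a₀ = 0) (h0ii : c₁ ∘ₗ b₀ = 0) (h0iii : c₁ ∘ₗ a₀ + e₁ ∘ₗ b₀ = 0)
    (h1i : a₀ ∘ₗ e₁ + e₂ ∘ₗ a₁ = 0) (h1ii : b₀ ∘ₗ c₁ + c₂ ∘ₗ b₁ = 0)
    (h1iii : a₀ ∘ₗ c₁ + c₂ ∘ₗ a₁ + b₀ ∘ₗ e₁ + e₂ ∘ₗ b₁ = 0)
    (h2i : a₁ ∘ₗ e₂ = 0) (h2ii : b₁ ∘ₗ c₂ = 0) (h2iii : a₁ ∘ₗ c₂ + b₁ ∘ₗ e₂ = 0) :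
    LinearMap.trace F M₁ (a₀ ∘ₗ c₁) = LinearMap.trace F M₂ (a₁ ∘ₗ c₂) := by
  -- the four middle-level loops, as elements of the endomorphism ring of M₁
  set P : Module.End F M₁ := a₀ ∘ₗ c₁ with hPdef
  set R : Module.End F M₁ := b₀ ∘ₗ e₁ with hRdef
  set P' : Module.End F M₁ := c₂ ∘ₗ a₁ with hP'def
  set R' : Module.End F M₁ := e₂ ∘ₗ b₁ with hR'def
  -- boundary relations: PR = RP = 0 (bottom), P'R' = R'P' = 0 (top)
  have hPR : P * R = 0 := by
    rw [Module.End.mul_eq_comp, hPdef, hRdef]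
    calc (a₀ ∘ₗ c₁) ∘ₗ (b₀ ∘ₗ e₁) = a₀ ∘ₗ (c₁ ∘ₗ b₀) ∘ₗ e₁ := by
          simp only [LinearMap.comp_assoc]
      _ = 0 := by rw [h0ii, LinearMap.zero_comp, LinearMap.comp_zero]
  have hRP : R * P = 0 := by
    rw [Module.End.mul_eq_comp, hPdef, hRdef]
    calc (b₀ ∘ₗ e₁) ∘ₗ (a₀ ∘ₗ c₁) = b₀ ∘ₗ (e₁ ∘ₗ a₀) ∘ₗ c₁ := by
          simp only [LinearMap.comp_assoc]
      _ = 0 := by rw [h0i, LinearMap.zero_comp, LinearMap.comp_zero]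
  have hP'R' : P' * R' = 0 := by
    rw [Module.End.mul_eq_comp, hP'def, hR'def]
    calc (c₂ ∘ₗ a₁) ∘ₗ (e₂ ∘ₗ b₁) = c₂ ∘ₗ (a₁ ∘ₗ e₂) ∘ₗ b₁ := by
          simp only [LinearMap.comp_assoc]
      _ = 0 := by rw [h2i, LinearMap.zero_comp, LinearMap.comp_zero]
  have hR'P' : R' * P' = 0 := by
    rw [Module.End.mul_eq_comp, hP'def, hR'def]
    calc (e₂ ∘ₗ b₁) ∘ₗ (c₂ ∘ₗ a₁) = e₂ ∘ₗ (b₁ ∘ₗ c₂) ∘ₗ a₁ := by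
          simp only [LinearMap.comp_assoc]
      _ = 0 := by rw [h2ii, LinearMap.zero_comp, LinearMap.comp_zero]
  -- the middle relations: P² = R'²
  have hca : c₁ ∘ₗ a₀ = -(e₁ ∘ₗ b₀) := eq_neg_of_add_eq_zero_left h0iii
  have hae : a₀ ∘ₗ e₁ = -(e₂ ∘ₗ a₁) := eq_neg_of_add_eq_zero_left h1i
  have hbc : b₀ ∘ₗ c₁ = -(c₂ ∘ₗ b₁) := eq_neg_of_add_eq_zero_left h1ii
  have hac : a₁ ∘ₗ c₂ = -(b₁ ∘ₗ e₂) := eq_neg_of_add_eq_zero_left h2iii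
  have hsq : P * P = R' * R' := by
    rw [Module.End.mul_eq_comp, Module.End.mul_eq_comp, hPdef, hR'def]
    calc (a₀ ∘ₗ c₁) ∘ₗ (a₀ ∘ₗ c₁) = a₀ ∘ₗ (c₁ ∘ₗ a₀) ∘ₗ c₁ := by
          simp only [LinearMap.comp_assoc]
      _ = -((a₀ ∘ₗ e₁) ∘ₗ (b₀ ∘ₗ c₁)) := by
          rw [hca, LinearMap.neg_comp, LinearMap.comp_neg]
          simp only [LinearMap.comp_assoc]
      _ = -((e₂ ∘ₗ a₁) ∘ₗ (c₂ ∘ₗ b₁)) := by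
          rw [hae, hbc, LinearMap.neg_comp, LinearMap.comp_neg, neg_neg]
      _ = -(e₂ ∘ₗ (a₁ ∘ₗ c₂) ∘ₗ b₁) := by simp only [LinearMap.comp_assoc]
      _ = (e₂ ∘ₗ b₁) ∘ₗ (e₂ ∘ₗ b₁) := by
          rw [hac, LinearMap.neg_comp, LinearMap.comp_neg, neg_neg]
          simp only [LinearMap.comp_assoc]
  -- the middle relation (iii): P + R = -(P' + R')
  have hsum : P + P' + R + R' = 0 := by
    rw [hPdef, hP'def, hRdef, hR'def]; exact h1iii
  have hΛ : P + R = -(P' + R') := by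
    apply eq_neg_of_add_eq_zero_left
    rw [← hsum]; abel
  -- consequences in the endomorphism ring
  have hR'Λ : R' * (P + R) = -(R' * R') := by
    rw [hΛ, mul_neg, mul_add, hR'P', zero_add]
  have hΛR' : (P + R) * R' = -(R' * R') := by
    rw [hΛ, neg_mul, add_mul, hP'R', zero_add]
  have hPΛ : P * (P + R) = P * P := by rw [mul_add, hPR, add_zero]
  have hΛP : (P + R) * P = P * P := by rw [add_mul, hRP, add_zero]
  have hΛN : (P + R) * (P + R') = 0 := by
    rw [mul_add, hΛP, hΛR', hsq, add_neg_cancel]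
  have htr : LinearMap.trace F M₁ (P + R') = 0 :=
    trace_eq_zero_of_sandwich P R' (P + R) hΛN (by rw [hΛP, hPΛ]) (by rw [hΛR', hR'Λ])
      hPΛ.symm (by rw [hR'Λ, neg_neg])
  -- read off the traces
  have htrR' : LinearMap.trace F M₁ R' = -LinearMap.trace F M₂ (a₁ ∘ₗ c₂) := by
    rw [hR'def, LinearMap.trace_comp_comm', ← map_neg, hac, neg_neg]
  rw [map_add, htrR'] at htr
  rwa [← sub_eq_add_neg, sub_eq_zero] at htr

end Summit.Ventures.HSemireg
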